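import Literature.AlgebraicGeometry.HodgeTheory.RealMultiplicationPowersHodgeClasses
import Literature.AlgebraicGeometry.Motives.HodgeThetaSubalgebraSymplecticBlocks
import HarnessLib

/-!
# Hodge classes on abelian varieties with slots over an abelian variety with real multiplication of RELATIVE DIMENSION TWO are invariants of `⊕_τ 𝔰𝔭(V_τ)` acting diagonally, place by place (Moonen–Zarhin 1995 Type I(2) «`Hg = R_{F/ℚ} Sp_{4,F}`»; Hazama 1983 §3; Murty 1984 §3; Ribet 1983 Thm. 0) — the Lie step in the word model, four-dimensional blocks

Family `hodge`, layer `Literature/AlgebraicGeometry/HodgeTheory`. Research context: cell `pub-hodge-ring2`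
(HONEST FRAMING: research route conditional on HC_CM; not a corollary; Q11.4-sentence-2 already refuted in
dim ≥ 3), Literature lane gen 70, programme R47 «type I(2) row of the row-four residual»: the analogue, for
real multiplication of relative dimension TWO (`End⁰(A) = F` a totally real field, `dim A = 2[F:ℚ]`,
four-dimensional eigenblocks `V_τ`, `Lie Hg(A) ⊗ ℂ = ⊕_τ 𝔰𝔭(V_τ)`), of the tree's relative-dimension-one
INVARIANCE THEOREM `AVSlots.exists_rmInvariant_coeff` (`RealMultiplicationPowersHodgeClasses` §1–§2,
two-dimensional blocks, `⊕ 𝔰𝔩₂`). THEOREMS ONLY (no definition, no named fact; D-0026); the tree-light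
Betti hypotheses `hHD`, `hI` and the instance `HodgeTensorFacts` are kept as binders exactly as in the
relative-dimension-one theorem (they are tree theorems: `exists_isReal_hodgeModel_holds`,
`hodgePQ_independent_of_hodgeModel_holds`, `hodgeTensorFacts_holds`); no step towards a summit statement.

PUBLISHED STATEMENTS. Moonen–Zarhin 1995 (Duke 77), Type I(2): a simple abelian fourfold `X` with
`End⁰(X) = F` real quadratic has `Hg(X) = R_{F/ℚ} Sp_{4,F}`; Murty 1984 §3 (Gordon 1997 §7.7, Prop. 7.7.1):
for type (I) the factors of `Lf(A)_ℝ`, indexed by the embeddings `F → ℝ`, are symplectic groups acting on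
the corresponding components of `H₁ ⊗ ℝ` by the standard representation, and `H*(A^k, ℚ)^{Lf(A)} = Div(A^k)`;
Ribet 1983 Thm. 0: `End⁰(A)` a field and `Hg(A) = Lf(A)` ⟹ `Hdg(Aⁿ) = Div(Aⁿ)`; Hazama 1983 §3: the Hodge
classes of `Aⁿ` are the invariants of `𝔥 ⊗ ℂ = ⊕_i 𝔤_i`, «the `i`-th component acts on `V_i ⊕ ⋯ ⊕ V_i`
diagonally». The Lie-algebra equality `Lie Hg ⊗ ℂ = ⊕_τ 𝔰𝔭(V_τ)` for EVERY degree `[F:ℚ]` — and, what is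
used here, for every ADMISSIBLE rational Lie algebra in place of `Lie Hg` — is the tree's theorem
`HodgeStructure.SpBlocksTheta.*` (`Motives/HodgeThetaSubalgebraSymplecticBlocks`, Deligne's minimality
principle LNM 900 I §3 with Moonen–Zarhin 1999 Lemma (3.4)).

SETTING. `A` a complex abelian variety with `End⁰(A) = F` a totally real FIELD and `2[F:ℚ] = dim A`; `B` an
abelian variety with a slot structure `g : Fin n → (B ⟶ A)` (`AVSlots`; e.g. `B = A^{N+1}`); `ψ` a
polarization of `H = H¹(A(ℂ); ℚ)`; `V_τ ⊆ H ⊗ ℂ` (`τ : F → ℂ`) the joint eigenspaces of `F`, FOUR-dimensional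
(`finrank_eigenBlock_hodgeCharacter_eq_four`); `b_τ` bases of the `V_τ` indexed by `Fin 4` and ADAPTED to
the Hodge decomposition through a kind map `kd : Fin 4 → Fin 2` (`b_τ r ∈ H^{1,0}` if `kd r = 0`, `∈ H^{0,1}`
if `kd r = 1`); the LETTERS of `B` are the classes `g_j^* b_τ r ∈ H¹(B(ℂ); ℂ)` indexed by `((j, τ), r)`.

MAIN RESULTS (all proved).
* §1 (generic word model, `m × m` blocks; the tree's `blockLift`/`placeRefine` lemmas of
  `RealMultiplicationPowersHodgeClasses` §1 are the case `m = 2` and are restated here for a matrix `L`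
  given by its block ENTRIES, so that no new definition is needed): `wordDerAt_blockEntries_wordSlice`,
  `wordDerAt_place_eq_zero_of_blockEntries`, `wordEval_blockLetters`.
* §2 `finrank_eigenBlock_hodgeCharacter_eq_four` (`dim_ℂ V_τ = 4` when `2[F:ℚ] = dim A`) and THE
  INVARIANCE THEOREM `AVSlots.exists_rm2Invariant_coeff`: every
  rational `(p,p)`-class on `B` (`p ≥ 1`) is `∑_w a(w) · (letters)_w` for a coefficient function `a` on words
  in the letters `((j, τ), r)` such that for every slot-and-place word `U`, every place `τ` and every
  `ψ_ℂ|_{V_τ}`-skew endomorphism `f` of `V_τ`, the matrix of `f` in `b_τ`, placed at the positions of place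
  `τ`, kills the slice `a(U, −)`.

NOT here (heirs, noted for the lane): the passage Lie algebra → group per place for `𝔰𝔭₄` in the coloured
word model, the coloured symplectic tensor FFT (`ClassicalInvariants/SymplecticTensorFFTColouredBlocks`) and
the `ψ`-Casimir classes giving `IsDivisorGenerated B`; existence of Hodge-adapted symplectic bases `b_τ`.

## References

* [MoonenZarhin1995Duke] B. Moonen, Yu. Zarhin, *Hodge classes and Tate classes on simple abelian
  fourfolds*, Duke Math. J. 77 (1995) 553–581, Type I(2). [cite: MoonenZarhin1995Duke, Type I(2)]
* [Murty1984] V. K. Murty, *Exceptional Hodge classes on certain abelian varieties*, Math. Ann. 268 (1984)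
  197–206, §3 (Lemma 2.3, the type (I) factor `Sp`). [cite: Murty1984, §3]
* [Ribet1983] K. A. Ribet, Amer. J. Math. 105 (1983) 523–538, Thm. 0. [cite: Ribet1983, Thm. 0]
* [Hazama1983] F. Hazama, Tôhoku Math. J. 35 (1983) 303–308, §3 pp. 305–306. [cite: Hazama1983, §3 (pp. 305–306)]
* [Gordon1997] B. B. Gordon, *A survey of the Hodge conjecture for abelian varieties*, arXiv:alg-geom/9709030,
  Thm. 6.2 and §7.7 Prop. 7.7.1 (held `paper:arxiv-alg-geom_9709030`, p0018, p0021). [cite: Gordon1997, Thm. 6.2 and §7.7]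
* [MoonenZarhin1999LowDim] B. Moonen, Yu. Zarhin, Math. Ann. 315 (1999), §2 (2.2)–(2.3), §3 (3.1), (3.4).
  [cite: MoonenZarhin1999LowDim, §3 (3.1) and (3.4)]
* [Deligne1982HodgeCycles] P. Deligne, LNM 900 (1982), I §3 (proof of Prop. 3.4). [cite: Deligne1982HodgeCycles, I §3]
* [GoodmanWallachGTM255] R. Goodman, N. R. Wallach, GTM 255 (2009), §4.1.1. [cite: GoodmanWallachGTM255, §4.1.1]
* [FultonYoungTableaux1997] W. Fulton, *Young Tableaux* (1997), §8.1. [cite: FultonYoungTableaux1997, §8.1]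
-/

noncomputable section

open scoped TensorProduct
open CategoryTheory Module NumberField

namespace Literature.AlgebraicGeometry.HodgeTheory

open Literature.AlgebraicTopology.SingularHomology
open Literature.AlgebraicGeometry.Motives (IsSmoothProjective AbelianVariety bettiCohomology
  ofRatClassBaseChange ofRatClassBaseChange_tmul HodgeTensorFacts hodgeTensorFacts_holds)
open Literature.Barriers.HodgeConjecture
open Literature.AlgebraicGeometry.Motives.HodgeStructure
open Literature.AlgebraicGeometry.ComplexMultiplication
open Literature.RepresentationTheory.GeneralLinear
open Literature.NumberTheory.DiophantineGeometry

/-! ### §1 Block matrices of `m × m` blocks placed in all slots, read along slot-and-place words -/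

section WordModel

variable {K : Type*} {J T : Type*} {N d m : ℕ}

/-- **A block matrix placed in all slots acts on a slice along a slot word as its blocks placed at the
positions of their places act on the refined slices.** Here `φ : Fin N ≃ T × Fin m` identifies the alphabet
with (place, index), `L` is the matrix of `⊕_τ Nf τ` in the collected basis (given by its entries `hL`), and
the refined coefficient function has letters `((slot, place), index)`. The case `m = 2` is the tree's
`wordDerAt_blockLift_wordSlice`. [cite: GoodmanWallachGTM255, §4.1.1] [cite: FultonYoungTableaux1997, §8.1] -/
theorem wordDerAt_blockEntries_wordSlice [Field K] [Fintype T] [DecidableEq T] (φ : Fin N ≃ T × Fin m)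
    (Nf : T → Matrix (Fin m) (Fin m) K) {L : Matrix (Fin N) (Fin N) K}
    (hL : ∀ i i', L i i' = if (φ i).1 = (φ i').1 then Nf (φ i').1 (φ i).2 (φ i').2 else 0)
    (a : (Fin d → J × Fin N) → K) (u : Fin d → J) (ε : Word N d) :
    wordDerAt K (fun _ : Fin d => L) (wordSlice a u) ε =
      wordDerAt K (fun t => Nf (φ (ε t)).1)
        (wordSlice (fun w : Fin d → (J × T) × Fin m => a fun t => ((w t).1.1, φ.symm ((w t).1.2, (w t).2)))
          fun t => (u t, (φ (ε t)).1)) fun t => (φ (ε t)).2 := by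
  rw [wordDerAt_apply, wordDerAt_apply]
  refine Finset.sum_congr rfl fun t _ => ?_
  rw [← φ.symm.sum_comp, Fintype.sum_prod_type, Finset.sum_eq_single (φ (ε t)).1]
  · refine Finset.sum_congr rfl fun r _ => ?_
    rw [hL, Equiv.apply_symm_apply, if_pos rfl]
    congr 1
    rw [wordSlice_apply, wordSlice_apply]
    congr 1
    funext s
    by_cases hs : s = t
    · subst hs
      simp only [Function.update_self]
    · simp only [Function.update_of_ne hs, Prod.mk.eta, Equiv.symm_apply_apply]
  · intro τ' _ hτ'
    refine Finset.sum_eq_zero fun r _ => ?_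
    rw [hL, Equiv.apply_symm_apply, if_neg (Ne.symm hτ'), zero_mul]
  · intro h
    exact absurd (Finset.mem_univ _) h

/-- **Corollary: the single block `M` of place `τ`, placed in all slots, kills all slices ⟹ `M` placed at
the positions of place `τ` kills all refined slices.** The case `m = 2` is the tree's
`wordDerAt_colourOp_placeRefine_eq_zero`. [cite: GoodmanWallachGTM255, §4.1.1] -/
theorem wordDerAt_place_eq_zero_of_blockEntries [Field K] [Fintype T] [DecidableEq T]
    (φ : Fin N ≃ T × Fin m) {a : (Fin d → J × Fin N) → K} (τ : T) (M : Matrix (Fin m) (Fin m) K)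
    {L : Matrix (Fin N) (Fin N) K}
    (hL : ∀ i i', L i i' = if (φ i).1 = (φ i').1 then
      (Pi.single τ M : T → Matrix (Fin m) (Fin m) K) (φ i').1 (φ i).2 (φ i').2 else 0)
    (h : ∀ u : Fin d → J, wordDerAt K (fun _ : Fin d => L) (wordSlice a u) = 0) (U : Fin d → J × T) :
    wordDerAt K (fun t => if (U t).2 = τ then M else 0)
      (wordSlice (fun w : Fin d → (J × T) × Fin m => a fun t => ((w t).1.1, φ.symm ((w t).1.2, (w t).2)))
        U) = 0 := by
  funext η
  set ε : Word N d := fun t => φ.symm ((U t).2, η t) with hε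
  have h1 := congrFun (h fun t => (U t).1) ε
  rw [wordDerAt_blockEntries_wordSlice φ (Pi.single τ M) hL] at h1
  have hU : (fun t => ((U t).1, (φ (ε t)).1)) = U := funext fun t => by
    rw [hε, Equiv.apply_symm_apply]
  have hη : (fun t => (φ (ε t)).2) = η := funext fun t => by rw [hε, Equiv.apply_symm_apply]
  have hfam : (fun t => (Pi.single τ M : T → Matrix (Fin m) (Fin m) K) (φ (ε t)).1) =
      fun t => if (U t).2 = τ then M else 0 := funext fun t => by
    rw [hε, Equiv.apply_symm_apply, Pi.single_apply]
  rw [hU, hη, hfam] at h1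
  rw [h1, Pi.zero_apply, Pi.zero_apply]

/-- **The evaluation is unchanged by the refinement of the letters** `(slot, letter) ↦ ((slot, place),
index)` (a bijection of the letters). The case `m = 2` is the tree's `wordEval_placeRefine`.
[cite: FultonYoungTableaux1997, §8.1] -/
theorem wordEval_blockLetters [CommRing K] [Fintype J] [Fintype T] {H M : Type*} [AddCommGroup H]
    [Module K H] [AddCommGroup M] [Module K M] (F : H [⋀^Fin d]→ₗ[K] M) (φ : Fin N ≃ T × Fin m)
    (x : J × Fin N → H) (a : (Fin d → J × Fin N) → K) :
    wordEval F (fun jr : (J × T) × Fin m => x (jr.1.1, φ.symm (jr.1.2, jr.2)))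
      (fun w : Fin d → (J × T) × Fin m => a fun t => ((w t).1.1, φ.symm ((w t).1.2, (w t).2))) =
      wordEval F x a := by
  let θ : (J × T) × Fin m ≃ J × Fin N :=
    { toFun := fun jr => (jr.1.1, φ.symm (jr.1.2, jr.2))
      invFun := fun jm => ((jm.1, (φ jm.2).1), (φ jm.2).2)
      left_inv := fun jr => by simp
      right_inv := fun jm => by simp }
  rw [wordEval_apply, wordEval_apply]
  exact Fintype.sum_equiv (Equiv.arrowCongr (Equiv.refl (Fin d)) θ) _ _ fun w => rfl

end WordModel

/-! ### §2 The invariance theorem for abelian varieties with slots over an abelian variety with real multiplication of relative dimension two -/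

section RM

variable {A B : AbelianVariety ℂ} {n : ℕ} {g : Fin n → (B ⟶ A)}

variable (hF : IsField A.endAlgebra)

/-- A number field has positive degree over `ℚ` (instance path through `NumberField`). [folklore] -/
private theorem finrank_pos_of_numberField'' (E : Type*) [Field E] [NumberField E] :
    0 < Module.finrank ℚ E :=
  Module.finrank_pos

include hF in
/-- `[End⁰(A) : ℚ] > 0` for `End⁰(A)` a field (a number field has positive degree). [folklore] -/
private theorem finrank_endAlgebra_pos_of_isField : 0 < Module.finrank ℚ A.endAlgebra := by
  have h := finrank_pos_of_numberField'' (EndField A hF)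
  rw [EndField.finrank_eq hF] at h
  exact h

include hF in
/-- `dim A > 0` when `2[End⁰(A) : ℚ] = dim A`. [folklore] -/
private theorem dim_pos_of_two_mul_finrank_eq (hdeg : 2 * Module.finrank ℚ A.endAlgebra = A.dim) : 0 < A.dim := by
  have h := finrank_endAlgebra_pos_of_isField hF
  omega

/-- **Each block `V_τ` is four-dimensional when `2[F : ℚ] = dim A`**:
`dim_ℂ V_τ · [F:ℚ] = dim_ℚ H¹ = 2 dim A = 4[F:ℚ]` (`EndAction.finrank_iInf_eigenspace_mul_finrank`,
`finrank_bettiCohomology_one`). Murty 1984 §3: for type (I) the factor of place `τ` acts through the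
standard representation of `Sp_{2m}`, here `2m = dim A/[F:ℚ] · 2 = 4`. [cite: Murty1984, §3]
[cite: MoonenZarhin1995Duke, Type I(2)] -/
theorem finrank_eigenBlock_hodgeCharacter_eq_four (hHD : exists_isReal_hodgeModel)
    (hI : hodgePQ_independent_of_hodgeModel) (hdeg : 2 * Module.finrank ℚ A.endAlgebra = A.dim)
    (τ : EndField A hF →+* ℂ) :
    Module.finrank ℂ
      ((BettiUniverse.hodge hHD (AbelianVariety.isSmoothProjective_holds (A := A)) 1).eigenBlock
        (hodgeCharacter hF hHD hI τ)) = 4 := by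
  haveI : FiniteDimensional ℚ (bettiCohomology A.X 1) := finite_bettiCohomology_one A
  rw [eigenBlock_hodgeCharacter]
  have h : Module.finrank ℂ ↥(⨅ e : EndField A hF, Module.End.eigenspace
      ((hOneAlgHom (EndField.toEndAlgebra hF).toRingHom e).baseChange ℂ) (τ e)) *
      Module.finrank ℚ (EndField A hF) = Module.finrank ℚ (bettiCohomology A.X 1) :=
    (hOneEndAction (EndField.toEndAlgebra hF).toRingHom hHD hI (A := A)).finrank_iInf_eigenspace_mul_finrank τ
  rw [finrank_bettiCohomology_one, EndField.finrank_eq, ← hdeg] at h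
  refine Nat.eq_of_mul_eq_mul_right (finrank_endAlgebra_pos_of_isField hF) ?_
  rw [h]
  ring

/-- The two elements of `Fin 2`. [folklore] -/
private theorem fin2_eq_zero_or_one' (r : Fin 2) : r = 0 ∨ r = 1 := by
  fin_cases r <;> simp

open scoped Classical in
/-- **The INVARIANCE THEOREM (relative dimension two; Moonen–Zarhin Type I(2) / Murty 1984 §3 / Hazama 1983
§3, Lie step, for abelian varieties with slots over `A`).** Let `A` be a complex abelian variety whose
endomorphism algebra is a totally real field `F` with `2[F:ℚ] = dim A`, `B` an abelian variety with slots
`g` over `A`, `ψ` a polarization of `H¹(A(ℂ); ℚ)`, and `b_τ` bases (indexed by `Fin 4`) of the eigenblocks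
`V_τ` adapted to the Hodge decomposition through the kind map `kd`. Then every rational class `c` of type
`(p,p)` on `B` (`p ≥ 1`) is `∑_w a(w) · (g b)_w` for a coefficient function `a` on words in the letters
`((j, τ), r)` such that for every slot-and-place word `U`, every place `τ` and every endomorphism `f` of
`V_τ` which is skew for `ψ_ℂ|_{V_τ}` (`f ∈ 𝔰𝔭(V_τ) ≅ 𝔰𝔭₄`), the matrix of `f` in `b_τ` placed at the
positions of place `τ` kills the slice `a(U, −)` («the `i`-th component acts on `V_i ⊕ ⋯ ⊕ V_i` diagonally»,
Hazama p. 306; the factor of place `τ` of `Lf(A)` is `Sp(V_τ)` in its standard representation, Murty §3).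
Proof, word for word the tree's relative-dimension-one `AVSlots.exists_rmInvariant_coeff`: (α) an
antisymmetric kind-balanced coefficient function `a_x` in the adapted letters; its transform `a_e` to the
rational letters `1 ⊗ e_i` is antisymmetric, hence RATIONAL; `Θ = diag(±1)` in the adapted letters kills
the balanced `a_x`, so the matrix of `Θ` kills `a_e`, i.e. `Θ ∈ 𝔞_ℂ` for the rational Lie algebra
`𝔞 ⊆ 𝔰𝔭_F(H¹, ψ)` of `a_e` (`annLie`; Deligne's descent); by the tree's theorem
`SpBlocksTheta.exists_mem_spanC_supported` (admissible Lie algebras on four-dimensional real blocks are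
`⊕_τ 𝔰𝔭(V_τ)` after complexification) `𝔞_ℂ` contains an operator `Y` equal to `f` on `V_τ` and `0` on the
other blocks; `Y` kills `a_e`; transport back to `a_x` and refine the letters to slot-and-place colours
(§1). [cite: MoonenZarhin1995Duke, Type I(2)] [cite: Murty1984, §3] [cite: Hazama1983, §3 (pp. 305–306)]
[cite: Ribet1983, Thm. 0] [cite: Deligne1982HodgeCycles, I §3 (proof of Prop. 3.4)] -/
theorem AVSlots.exists_rm2Invariant_coeff [HodgeTensorFacts.{0, 0}] (hg : AVSlots A B g)
    (hHD : exists_isReal_hodgeModel) (hI : hodgePQ_independent_of_hodgeModel)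
    [IsTotallyReal (EndField A hF)] (hdeg : 2 * Module.finrank ℚ A.endAlgebra = A.dim)
    (ψ : (BettiUniverse.hodge hHD (AbelianVariety.isSmoothProjective_holds (A := A)) 1).Polarization)
    (b : ∀ τ : EndField A hF →+* ℂ, Module.Basis (Fin 4) ℂ
      ((BettiUniverse.hodge hHD (AbelianVariety.isSmoothProjective_holds (A := A)) 1).eigenBlock
        (hodgeCharacter hF hHD hI τ)))
    (kd : Fin 4 → Fin 2)
    (hb0 : ∀ τ r, kd r = 0 → (b τ r : ℂ ⊗[ℚ] bettiCohomology A.X 1) ∈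
      (BettiUniverse.hodge hHD (AbelianVariety.isSmoothProjective_holds (A := A)) 1).piece 1 0)
    (hb1 : ∀ τ r, kd r = 1 → (b τ r : ℂ ⊗[ℚ] bettiCohomology A.X 1) ∈
      (BettiUniverse.hodge hHD (AbelianVariety.isSmoothProjective_holds (A := A)) 1).piece 0 1)
    {p : ℕ} (hp : 0 < p) {c : complexBetti B.X (2 * p)} (hcQ : IsRationalClass c)
    (hc : IsOfHodgeType B.dim B.X (2 * p) p p c) :
    ∃ a : (Fin (2 * p) → (Fin n × (EndField A hF →+* ℂ)) × Fin 4) → ℂ,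
      wordEval (cupPowOneAlt ℂ (Motives.ComplexPoints B.X) (2 * p))
        (fun jr : (Fin n × (EndField A hF →+* ℂ)) × Fin 4 => complexBetti.map (g jr.1.1).hom.hom.hom 1
          (ofRatClassBaseChange (Motives.ComplexPoints A.X) 1
            (b jr.1.2 jr.2 : ℂ ⊗[ℚ] bettiCohomology A.X 1))) a = c ∧
      ∀ (U : Fin (2 * p) → Fin n × (EndField A hF →+* ℂ)) (τ : EndField A hF →+* ℂ)
        (f : Module.End ℂ ↥((BettiUniverse.hodge hHD (AbelianVariety.isSmoothProjective_holds (A := A)) 1).eigenBlock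
          (hodgeCharacter hF hHD hI τ))),
        (∀ x y : (BettiUniverse.hodge hHD (AbelianVariety.isSmoothProjective_holds (A := A)) 1).eigenBlock
            (hodgeCharacter hF hHD hI τ),
          ψ.form.baseChange ℂ ((f x : _) : ℂ ⊗[ℚ] bettiCohomology A.X 1) y +
            ψ.form.baseChange ℂ (x : ℂ ⊗[ℚ] bettiCohomology A.X 1) ((f y : _) : ℂ ⊗[ℚ] bettiCohomology A.X 1) = 0) →
        wordDerAt ℂ (fun t => if (U t).2 = τ then LinearMap.toMatrix (b τ) (b τ) f else 0)
          (wordSlice a U) = 0 := by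
  classical
  -- the setting
  have hX : IsSmoothProjective A.dim A.X := AbelianVariety.isSmoothProjective_holds
  haveI : Module.Finite ℚ (bettiCohomology A.X 1) := finite_bettiCohomology_one A
  have hint := isInternal_eigenBlock_hodgeCharacter hF hHD hI
  have h4 := finrank_eigenBlock_hodgeCharacter_eq_four hF hHD hI hdeg
  have hreal := hodgeCharacter_isReal hF hHD hI
  have hA0 : 0 < A.dim := dim_pos_of_two_mul_finrank_eq hF hdeg
  have hself := isAdjointPair_self_of_isTotallyReal hF hHD hI hA0 ψ
  have heff : (BettiUniverse.hodge hHD hX 1).IsEffective := BettiUniverse.hodge_isEffective hHD hX 1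
  set F := cupPowOneAlt ℂ (Motives.ComplexPoints B.X) (2 * p) with hFdef
  have hFinj : Function.Injective (exteriorPower.alternatingMapLinearEquiv F) :=
    injective_alternatingMapLinearEquiv_cupPowOneAlt B (2 * p)
  -- bases: the block basis `cbσ` and the rational basis `eC`, both indexed by `Fin M`
  set cbx : Module.Basis ((EndField A hF →+* ℂ) × Fin 4) ℂ (ℂ ⊗[ℚ] bettiCohomology A.X 1) :=
    (hint.collectedBasis b).reindex (Equiv.sigmaEquivProd (EndField A hF →+* ℂ) (Fin 4)) with hcbxdef
  set eQ := Module.finBasis ℚ (bettiCohomology A.X 1) with heQ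
  set eC : Module.Basis (Fin (Module.finrank ℚ (bettiCohomology A.X 1))) ℂ
    (ℂ ⊗[ℚ] bettiCohomology A.X 1) := Algebra.TensorProduct.basis ℂ eQ with heC
  set φ : Fin (Module.finrank ℚ (bettiCohomology A.X 1)) ≃ (EndField A hF →+* ℂ) × Fin 4 :=
    eC.indexEquiv cbx with hφ
  set cbσ : Module.Basis (Fin (Module.finrank ℚ (bettiCohomology A.X 1))) ℂ
    (ℂ ⊗[ℚ] bettiCohomology A.X 1) := cbx.reindex φ.symm with hcbσdef
  have hcbx : ∀ τr : (EndField A hF →+* ℂ) × Fin 4,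
      (cbx τr : ℂ ⊗[ℚ] bettiCohomology A.X 1) = b τr.1 τr.2 := by
    intro τr
    rw [hcbxdef, Module.Basis.reindex_apply, DirectSum.IsInternal.collectedBasis_coe]
    rfl
  have hcbσ : ∀ m, (cbσ m : ℂ ⊗[ℚ] bettiCohomology A.X 1) = b (φ m).1 (φ m).2 := fun m => by
    rw [hcbσdef, Module.Basis.reindex_apply, Equiv.symm_symm, hcbx]
  -- letters
  set ρ := ofRatClassBaseChangeEquiv hX 1 with hρ
  set v : Module.Basis _ ℂ (complexBetti A.X 1) := cbσ.map ρ with hv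
  set eL : Module.Basis _ ℂ (complexBetti A.X 1) := eC.map ρ with heL
  have heLQ : ∀ i, IsRationalClass (eL i) := fun i => by
    rw [heL, Module.Basis.map_apply, heC, Algebra.TensorProduct.basis_apply, hρ,
      ofRatClassBaseChangeEquiv_apply, ofRatClassBaseChange_tmul, one_smul]
    exact isRationalClass_ofRatClass _
  set κ : Fin (Module.finrank ℚ (bettiCohomology A.X 1)) → Fin 2 := fun m => kd (φ m).2 with hκ
  have hv_apply : ∀ m, v m = ofRatClassBaseChange (Motives.ComplexPoints A.X) 1
      (b (φ m).1 (φ m).2 : ℂ ⊗[ℚ] bettiCohomology A.X 1) := fun m => by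
    rw [hv, Module.Basis.map_apply, hcbσ, hρ, ofRatClassBaseChangeEquiv_apply]
  have hv0 : ∀ m, κ m = 0 → IsOfHodgeType A.dim A.X 1 1 0 (v m) := by
    intro m hm
    rw [hv_apply, ← BettiUniverse.mem_hodge_piece_iff hHD hI hX (k := 1) (p := 1) (q := 0) rfl]
    exact hb0 (φ m).1 (φ m).2 hm
  have hv1 : ∀ m, κ m = 1 → IsOfHodgeType A.dim A.X 1 0 1 (v m) := by
    intro m hm
    rw [hv_apply, ← BettiUniverse.mem_hodge_piece_iff hHD hI hX (k := 1) (p := 0) (q := 1) rfl]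
    exact hb1 (φ m).1 (φ m).2 hm
  -- (α) an antisymmetric kind-balanced coefficient function in the adapted letters
  obtain ⟨ax, hax_bal, hax_anti, hcax⟩ := hg.exists_antisymm_kindBalanced_wordEval_eq v κ hv0 hv1 hp hc
  -- the change of letters to the rational letters
  set G : Matrix _ _ ℂ := eC.toMatrix cbσ with hG
  set G' : Matrix _ _ ℂ := cbσ.toMatrix eC with hG'
  have hG'G : G' * G = 1 := cbσ.toMatrix_mul_toMatrix_flip eC
  have hve : ∀ m, v m = ∑ i, G i m • eL i := fun m => by
    simp only [hv, heL, Module.Basis.map_apply, ← map_smul, ← map_sum]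
    congr 1
    exact (eC.sum_toMatrix_smul_self (v := ⇑cbσ) (j := m)).symm
  have hletters : ∀ j m, avLetters g v (j, m) = ∑ i, G i m • avLetters g eL (j, i) :=
    avLetters_baseChange g G hve
  set aE := colourChangeAt (fun _ : Fin n => G) ax with haE
  have haE_anti : IsAntisymm aE := hax_anti.colourChangeAt _
  have hcaE : wordEval F (avLetters g eL) aE = c := by
    rw [haE, ← wordEval_eq_wordEval_colourChangeAt F (fun _ : Fin n => G) hletters ax, hcax]
  -- rationality of `aE`
  obtain ⟨q, hq⟩ := hg.exists_rat_wordEval_eq eL heLQ hcQ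
  obtain ⟨q', -, haEq⟩ := haE_anti.exists_eq_algebraMap_of_wordEval_eq hFinj (hg.letterBasis eL)
    (q := q) (by rw [AVSlots.coe_letterBasis, hcaE, hFdef, hq])
  have hslice_e : ∀ u, wordSlice aE u = wordRepAt ℂ (fun _ : Fin (2 * p) => G) (wordSlice ax u) :=
    fun u => wordSlice_colourChangeAt (fun _ : Fin n => G) ax u
  -- the Hodge operator `Θ`: `diag(±1)` in the adapted letters
  obtain ⟨Θ, hΘ⟩ := exists_hodgeTheta (BettiUniverse.hodge hHD hX 1)
  have hΘb : ∀ m, Θ (cbσ m) = (if κ m = 0 then (1 : ℂ) else -1) • cbσ m := by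
    intro m
    rcases fin2_eq_zero_or_one' (κ m) with h0 | h1
    · rw [if_pos h0, hcbσ]
      have hmem : (b (φ m).1 (φ m).2 : ℂ ⊗[ℚ] bettiCohomology A.X 1) ∈
          (BettiUniverse.hodge hHD hX 1).piece 1 (((1 : ℕ) : ℤ) - 1) := by
        have e : (((1 : ℕ) : ℤ) - 1) = 0 := by norm_num
        rw [e]; exact hb0 _ _ h0
      rw [hΘ 1 _ hmem]
      norm_num
    · rw [if_neg (by rw [h1]; exact one_ne_zero), hcbσ]
      have hmem : (b (φ m).1 (φ m).2 : ℂ ⊗[ℚ] bettiCohomology A.X 1) ∈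
          (BettiUniverse.hodge hHD hX 1).piece 0 (((1 : ℕ) : ℤ) - 0) := by
        have e : (((1 : ℕ) : ℤ) - 0) = 1 := by norm_num
        rw [e]; exact hb1 _ _ h1
      rw [hΘ 0 _ hmem]
      norm_num
  have hΘcb : LinearMap.toMatrix cbσ cbσ Θ = kindDiag κ := by
    ext i m
    rw [LinearMap.toMatrix_apply, hΘb, map_smul, Module.Basis.repr_self, Finsupp.smul_apply,
      Finsupp.single_apply, kindDiag, Matrix.diagonal_apply, smul_eq_mul, mul_ite, mul_one, mul_zero]
    by_cases him : i = m
    · subst him; rw [if_pos rfl]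
    · rw [if_neg (Ne.symm him), if_neg him]
  have hJG : LinearMap.toMatrix eC eC Θ * G = G * kindDiag κ := by
    rw [← hΘcb, hG, linearMap_toMatrix_mul_basis_toMatrix, basis_toMatrix_mul_linearMap_toMatrix]
  have hΘq : ∀ u : Fin (2 * p) → Fin n, wordDerAt ℂ (fun _ : Fin (2 * p) => LinearMap.toMatrix eC eC Θ)
      (wordSlice (fun w => algebraMap ℚ ℂ (q' w)) u) = 0 := by
    intro u
    rw [← haEq, hslice_e]
    refine wordDerAt_wordRepAt_eq_zero_of_mul_eq ℂ (fun _ : Fin (2 * p) => G) (fun _ => hJG) ?_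
    rw [wordDerAt_const]
    exact wordDer_kindDiag_wordSlice_eq_zero κ hax_bal u
  -- the rational Lie algebra `𝔞 ⊆ 𝔰𝔭_F(H¹, ψ)` of the rational tensor `q'`; `Θ ∈ 𝔞_ℂ`
  set 𝔞 : Submodule ℚ (Module.End ℚ (bettiCohomology A.X 1)) := annLie ψ.form eQ
    (fun a' : (BettiUniverse.hodge hHD hX 1).endAlg => (a' : Module.End ℚ (bettiCohomology A.X 1))) q'
    with h𝔞
  have hΘC : Θ ∈ (BettiUniverse.hodge hHD hX 1).hodgeLieC :=
    (BettiUniverse.hodge hHD hX 1).mem_hodgeLieC_of_forall_piece hΘ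
  have hΘ𝔞 : Θ ∈ spanC 𝔞 :=
    mem_spanC_annLie ψ.form eQ _ q' hΘq
      (fun a' => commute_baseChange_of_mem_hodgeLieC (BettiUniverse.hodge hHD hX 1) hΘC a')
      fun x y => by rw [formBaseChange_skew_of_mem_hodgeLieC ψ hΘC, neg_add_cancel]
  have hbr : ∀ X ∈ 𝔞, ∀ X' ∈ 𝔞, X * X' - X' * X ∈ 𝔞 := fun X hX' X' hX'' =>
    commutator_mem_annLie ψ.form eQ _ q' hX' hX''
  have hcomm : ∀ X ∈ 𝔞, ∀ a' : (BettiUniverse.hodge hHD hX 1).endAlg,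
      X * (a' : Module.End ℚ (bettiCohomology A.X 1)) = (a' : Module.End ℚ (bettiCohomology A.X 1)) * X :=
    fun X hX' a' => ((mem_annLie_iff ψ.form eQ _ q' X).1 hX').2.1 a'
  have hskew : ∀ X ∈ 𝔞, ∀ v' w, ψ.form (X v') w + ψ.form v' (X w) = 0 :=
    fun X hX' => ((mem_annLie_iff ψ.form eQ _ q' X).1 hX').2.2
  -- the coefficient function, refined to slot-and-place colours
  refine ⟨fun w => ax fun t => ((w t).1.1, φ.symm ((w t).1.2, (w t).2)), ?_, fun U τ f hf => ?_⟩
  · rw [← hcax]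
    have hx : (fun jr : (Fin n × (EndField A hF →+* ℂ)) × Fin 4 =>
        avLetters g v (jr.1.1, φ.symm (jr.1.2, jr.2))) =
        fun jr : (Fin n × (EndField A hF →+* ℂ)) × Fin 4 => complexBetti.map (g jr.1.1).hom.hom.hom 1
          (ofRatClassBaseChange (Motives.ComplexPoints A.X) 1
            (b jr.1.2 jr.2 : ℂ ⊗[ℚ] bettiCohomology A.X 1)) := by
      funext jr
      rw [avLetters_apply, hv_apply, Equiv.apply_symm_apply]
    rw [← hx]
    exact wordEval_blockLetters F φ (avLetters g v) ax
  · -- an element `Y ∈ 𝔞_ℂ` equal to `f` on `V_τ` and to `0` on the other blocks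
    obtain ⟨Y, hY, hYf, hY0⟩ := SpBlocksTheta.exists_mem_spanC_supported (BettiUniverse.hodge hHD hX 1)
      Nat.cast_one heff ψ hself (hodgeCharacter hF hHD hI) hreal hint h4 𝔞 hbr hΘ hΘ𝔞 hcomm hskew τ f hf
    have hL : ∀ u : Fin (2 * p) → Fin n, wordDerAt ℂ (fun _ : Fin (2 * p) => LinearMap.toMatrix eC eC Y)
        (wordSlice (fun w => algebraMap ℚ ℂ (q' w)) u) = 0 := fun u => by
      rw [h𝔞] at hY
      exact wordDerAt_eq_zero_of_mem_spanC_annLie ψ.form eQ _ q' hY u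
    -- `Y` kills the slices of `a_x` (transport through `G`)
    have hkill : ∀ u : Fin (2 * p) → Fin n,
        wordDerAt ℂ (fun _ : Fin (2 * p) => LinearMap.toMatrix cbσ cbσ Y) (wordSlice ax u) = 0 := by
      intro u
      have h1 := hL u
      rw [← haEq, hslice_e] at h1
      have hYG : ∀ _t : Fin (2 * p),
          LinearMap.toMatrix eC eC Y * G = G * LinearMap.toMatrix cbσ cbσ Y := fun _ => by
        rw [hG, linearMap_toMatrix_mul_basis_toMatrix, basis_toMatrix_mul_linearMap_toMatrix]
      have h3 : wordRepAt ℂ (fun _ : Fin (2 * p) => G)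
          (wordDerAt ℂ (fun _ : Fin (2 * p) => LinearMap.toMatrix cbσ cbσ Y) (wordSlice ax u)) = 0 := by
        rw [wordRepAt_wordDerAt_of_mul_eq ℂ (fun _ : Fin (2 * p) => G) hYG, h1]
      exact wordRepAt_injective ℂ (g := fun _ : Fin (2 * p) => G) (g' := fun _ : Fin (2 * p) => G')
        (funext fun _ => hG'G) (by rw [h3, map_zero])
    -- the matrix of `Y` in the block basis: the single block `[f]_{b_τ}` at place `τ`
    have hblk : ∀ i i', LinearMap.toMatrix cbσ cbσ Y i i' = if (φ i).1 = (φ i').1 then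
        (Pi.single τ (LinearMap.toMatrix (b τ) (b τ) f) :
          (EndField A hF →+* ℂ) → Matrix (Fin 4) (Fin 4) ℂ) (φ i').1 (φ i).2 (φ i').2 else 0 := by
      intro i i'
      rw [LinearMap.toMatrix_apply, hcbσ i']
      by_cases hk : (φ i').1 = τ
      · subst hk
        rw [Pi.single_eq_same, ← hYf]
        have hfx : (((f (b (φ i').1 (φ i').2) : _) : ℂ ⊗[ℚ] bettiCohomology A.X 1)) =
            ∑ a', LinearMap.toMatrix (b (φ i').1) (b (φ i').1) f a' (φ i').2 •
              cbσ (φ.symm ((φ i').1, a')) := by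
          conv_lhs => rw [← (b (φ i').1).sum_repr (f (b (φ i').1 (φ i').2))]
          rw [Submodule.coe_sum]
          refine Finset.sum_congr rfl fun a' _ => ?_
          rw [Submodule.coe_smul, LinearMap.toMatrix_apply, hcbσ, Equiv.apply_symm_apply]
        rw [hfx, map_sum, Finset.sum_apply']
        simp only [map_smul, Module.Basis.repr_self, Finsupp.smul_apply, Finsupp.single_apply,
          smul_eq_mul, mul_ite, mul_one, mul_zero]
        by_cases h : (φ i).1 = (φ i').1
        · rw [if_pos h, Finset.sum_eq_single (φ i).2]
          · rw [if_pos]; rw [← h, Prod.mk.eta, Equiv.symm_apply_apply]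
          · intro a' _ ha'
            rw [if_neg]
            intro hia
            apply ha'
            rw [← hia, Equiv.apply_symm_apply]
          · intro hh; exact absurd (Finset.mem_univ _) hh
        · rw [if_neg h]
          refine Finset.sum_eq_zero fun a' _ => ?_
          rw [if_neg]
          intro hia
          apply h
          rw [← hia, Equiv.apply_symm_apply]
      · rw [hY0 (φ i').1 hk _ (b (φ i').1 (φ i').2).2, map_zero, Finsupp.zero_apply]
        by_cases h : (φ i).1 = (φ i').1
        · rw [if_pos h, Pi.single_eq_of_ne hk, Matrix.zero_apply]
        · rw [if_neg h]
    exact wordDerAt_place_eq_zero_of_blockEntries φ τ (LinearMap.toMatrix (b τ) (b τ) f) hblk hkill U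

end RM

end Literature.AlgebraicGeometry.HodgeTheory

end
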